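import Summits.BirchSwinnertonDyer.BirchSwinnertonDyer.Theorems.PrintX11aUpperNonSurjFiveMultTeichDefs
import Summits.BirchSwinnertonDyer.BirchSwinnertonDyer.Theorems.PrintX11aMuCosetDoor
import Summits.BirchSwinnertonDyer.BirchSwinnertonDyer.Theorems.SmallImageMuTransferAnalyticMuZeroX9TeichOrbitNonConstantAtOfTeichSpanGenAll
import Literature.NumberTheory.EllipticCurves.PAdicLFunctionIntegralityProofs
import HarnessLib

/-!
# Crux U5 `PrintX11a.UpperNonSurjFive` (item stmt-BirchSwinnertonDyer-20614), line finemu5 r2 ⊕ multteich5 —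
# stub S3 `stub_multMuAn_of_orbitUnit`, PROVED: a unit Teichmüller orbit sum ⟹ a unit coefficient of `ϖ·L_p(E,T)`

Seat `bsd-line-x11a-p3` g2 (LEAD of crux 20614), `--supports stmt-BirchSwinnertonDyer-20614` (registered stub S3 of the
reshaped skeleton of record, `ledger skeleton check` 2026-08-28T07:2xZ).  Theorems only (no definition, no named fact, no
`sorry`); CONDITIONAL on the displayed fact `mazur_not_dvd_maninConstant_of_odd` (Mazur 1978 Cor. 4.1; conjunct 9 of item
19949); the second displayed hypothesis (Wuthrich 2014 Cor. 18, conjunct 22) is carried for the registered signature and not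
used.  Vocabulary: `Theorems/PrintX11aUpperNonSurjFiveMultTeichDefs.lean` (p611571).

THE BOOKKEEPING (Mazur–Tate–Teitelbaum §I.10–I.13 at `p ∥ N`; assembled from tree theorems only):
* `sum_filter_pow_eq_one_mul_eq` — reindexing a Teichmüller-coset sum by a unit: `Σ_{η^{p−1}=1} g(ηu) = Σ_{b^{p−1}=u^{p−1}} g(b)`.
* `exists_norm_finsum_coset_eq_one_of_teichOrbitSum` — at level `n + e₀`: a unit `u` is some class `ξ₀·γ^{s₀}`
  (`MuCoset.exists_classMap_eq`), so its Teichmüller coset is `{ξ·γ^{s₀}}` = the finset `{b : b^{p−1} = γ^{(p−1)s₀}}`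
  (`MuCoset.finsum_coset_eq_sum_filter`), and the coset sum of the table `ϖ·[·/p^{n+e₀}]⁺_f` in the tree's `∑ᶠ ξ` currency is
  `ϖ·A_{n+e₀}(u)`; with `‖ϖ‖_p = 1`, `p`-integral symbols and `‖A‖_p ≥ 1` it has norm EXACTLY `1`.
* `stub_multMuAn_of_orbitUnit` — THE REGISTERED STUB S3: for `E = W/ℚ` with multiplicative reduction at `p ≥ 5` and `E[p]`
  irreducible, `MultTeichOrbitUnitAt W p → MultMuAnAt W p`.  Per newform `f` and period ratio `ϖ` (`ϖ·Ω_E = Ω⁺_f`): `‖ϖ‖_p = 1`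
  (`X11b.ClassClosure.norm_ratCast_periodRatio_eq_one_of_mazur`); `‖[0]⁺_f‖_p ≤ 1` from irreducibility (the Eisenstein multiple
  `n₀{∞,0} ∈ Λ_f`, `p ∤ n₀`: `exists_intCast_mul_modularSymbol_zero_mem` + `norm_ratPlusSymbol_le_one`); hence ALL `[a/pᵐ]⁺_f` are
  `p`-integral (`IsNewformOf.norm_ratPlusSymbol_val_div_le_max_of_multiplicative`); the unit orbit sum lives at a level `n₁ ≥ 1 =
  e₀`, so `n₁ = n + e₀`; the previous bullet gives a unit coset sum in the `∑ᶠ ξ` currency, and the tree's certificate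
  `MuCoset.exists_norm_coeff_eq_one_of_cosetSum_split` (`a = 1`, via `isMultPAdicLFunctionOf_one_iff`) resp. `…_nonsplit` (`a = −1`)
  yields a coefficient of `ϖ·L` of norm `1` (below degree `pⁿ`).  No analytic-rank hypothesis is needed.
HONEST FRAMING: per pair the input `MultTeichOrbitUnitAt` is a finite certificate; class-wide it is produced from the OPEN S1 by the
landed S2 — nothing about any curve is asserted unconditionally; the crux stays open.  beyond-print theorem: no.  BSD is not proved
by any of this.
References: [MazurTateTeitelbaum1986Invent] §I.10 (10.1), §I.12–I.13; [Mazur1978] Cor. 4.1; [Washington1997] §5.1, §7.2;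
[GreenbergVatsal2000] §3 Rem. 3.4.
-/

-- the summit namespace repeats `BirchSwinnertonDyer` by design (summit = problem); linter moot
set_option linter.dupNamespace false
set_option autoImplicit false

noncomputable section

open scoped Classical MatrixGroups ModularForm
open CongruenceSubgroup
open Literature.NumberTheory.EllipticCurves.Rank1Residual

namespace Summit.BirchSwinnertonDyer.BirchSwinnertonDyer.Cruxes.UpperNonSurjFive.MultTeich

open WeierstrassCurve
  Literature.NumberTheory.EllipticCurves Literature.NumberTheory.EllipticCurves.ModularForms
  Summit.BirchSwinnertonDyer.Rank1Residual
  Summit.BirchSwinnertonDyer.BirchSwinnertonDyer.Theorems.CollapseThree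
  Summit.BirchSwinnertonDyer.BirchSwinnertonDyer.Cruxes.AnalyticMuZeroX9.TeichSpan

/-! ### §A Reindexing a Teichmüller-coset sum by a unit -/

section Reindex

variable {p : ℕ} [Fact p.Prime]

/-- **Reindexing by a unit**: `Σ_{η^{p−1}=1} g(η·u) = Σ_{b^{p−1}=u^{p−1}} g(b)` in `ℤ/pⁿ` (`η ↦ η·u` is a bijection from the
`(p−1)`-st roots of unity onto the solutions of `b^{p−1} = u^{p−1}`). [cite: Washington1997, §5.1 (Teichmüller character ω)] -/
theorem sum_filter_pow_eq_one_mul_eq {n : ℕ} (u : (ZMod (p ^ n))ˣ) {M : Type*} [AddCommMonoid M]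
    (g : ZMod (p ^ n) → M) :
    ∑ t ∈ Finset.univ.filter (fun t : ZMod (p ^ n) ↦ t ^ (p - 1) = 1), g (t * (u : ZMod (p ^ n))) =
      ∑ b ∈ Finset.univ.filter (fun b : ZMod (p ^ n) ↦ b ^ (p - 1) = (u : ZMod (p ^ n)) ^ (p - 1)), g b := by
  classical
  have himg : (Finset.univ.filter (fun t : ZMod (p ^ n) ↦ t ^ (p - 1) = 1)).image
      (fun t ↦ t * (u : ZMod (p ^ n))) =
      Finset.univ.filter (fun b : ZMod (p ^ n) ↦ b ^ (p - 1) = (u : ZMod (p ^ n)) ^ (p - 1)) := by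
    ext b
    simp only [Finset.mem_image, Finset.mem_filter, Finset.mem_univ, true_and]
    constructor
    · rintro ⟨t, ht, rfl⟩
      rw [mul_pow, ht, one_mul]
    · intro hb
      refine ⟨b * ((u⁻¹ : (ZMod (p ^ n))ˣ) : ZMod (p ^ n)), ?_, ?_⟩
      · rw [mul_pow, hb, ← Units.val_pow_eq_pow_val, ← Units.val_pow_eq_pow_val, ← Units.val_mul, inv_pow,
          mul_inv_cancel, Units.val_one]
      · rw [mul_assoc, Units.inv_mul, mul_one]
  rw [← himg, Finset.sum_image]
  intro t _ t' _ h
  exact (Units.mul_left_inj u).mp h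

end Reindex

/-! ### §B A unit orbit sum is a unit coset sum in the `∑ᶠ ξ` currency of the tree's certificate -/

section Coset

variable {N : ℕ} [NeZero N] (f : CuspForm (Gamma0 N) 2) {p : ℕ} [Fact p.Prime]

omit [NeZero N] in
/-- **A unit orbit sum at level `n + e₀` is a unit Teichmüller-coset sum of the Néron-normalised table** `ϖ·[·]⁺_f`, in the
currency of `MuCoset.exists_norm_coeff_eq_one_of_cosetSum_{split,nonsplit}`: the unit `u = ξ₀·γ^{s₀}` (`MuCoset.exists_classMap_eq`),
the coset `{ξ·γ^{s₀}} = {b : b^{p−1} = γ^{(p−1)s₀}} = {b : b^{p−1} = u^{p−1}} = u·μ_{p−1}` (`MuCoset.finsum_coset_eq_sum_filter`,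
`sum_filter_pow_eq_one_mul_eq`), so the coset sum is `ϖ·A(u)`, of norm `‖ϖ‖·‖A(u)‖ = 1` when `‖ϖ‖ = 1`, the symbols are integral and
`‖A(u)‖ ≥ 1`. [cite: MazurTateTeitelbaum1986Invent, §I.10 (10.1) and §I.13] [cite: Washington1997, §5.1 and §7.2] -/
theorem exists_norm_finsum_coset_eq_one_of_teichOrbitSum (hp2 : p ≠ 2) (ϖ : ℚ) (hϖ1 : ‖((ϖ : ℚ) : ℚ_[p])‖ = 1)
    (hint : ∀ (k n : ℕ), ‖((ratPlusSymbol f ((k : ℚ) / (p : ℚ) ^ n) : ℚ) : ℚ_[p])‖ ≤ 1)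
    (n : ℕ) (u : (ZMod (p ^ (n + cyclotomicExponent p)))ˣ)
    (hu : 1 ≤ ‖((teichOrbitSum f p (n + cyclotomicExponent p) (u : ZMod (p ^ (n + cyclotomicExponent p))) : ℚ) :
      ℚ_[p])‖) :
    ∃ s₀ : ZMod (p ^ n), ‖∑ᶠ ξ : rootsOfUnity (torsionOrder p) ℤ_[p],
        ((ϖ * ratPlusSymbol f
          (((PadicInt.toZModPow (n + cyclotomicExponent p) ((ξ : ℤ_[p]ˣ) : ℤ_[p]) *
              (cyclotomicGenerator p : ZMod (p ^ (n + cyclotomicExponent p))) ^ s₀.val).val : ℚ) /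
            (p : ℚ) ^ (n + cyclotomicExponent p)) : ℚ) : ℚ_[p])‖ = 1 := by
  classical
  obtain ⟨ξ₀, s₀, hξs⟩ := X11a.MuCoset.exists_classMap_eq p n u
  refine ⟨s₀, ?_⟩
  have hτ : torsionOrder p = p - 1 := by rw [torsionOrder_eq, if_neg hp2]
  -- `u^{τ} = γ^{τ·s₀}`
  have hupow : (u : ZMod (p ^ (n + cyclotomicExponent p))) ^ torsionOrder p =
      (cyclotomicGenerator p : ZMod (p ^ (n + cyclotomicExponent p))) ^ (torsionOrder p * s₀.val) := by
    rw [← hξs, mul_pow, ← map_pow, rootsOfUnity_pow_torsionOrder, map_one, one_mul, ← pow_mul, mul_comm]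
  rw [X11a.MuCoset.finsum_coset_eq_sum_filter p hp2 n s₀ (fun b ↦ ((ϖ * ratPlusSymbol f
      ((b.val : ℚ) / (p : ℚ) ^ (n + cyclotomicExponent p)) : ℚ) : ℚ_[p])), ← hupow, hτ,
    ← sum_filter_pow_eq_one_mul_eq u]
  have hsum : (∑ t ∈ Finset.univ.filter (fun t : ZMod (p ^ (n + cyclotomicExponent p)) ↦ t ^ (p - 1) = 1),
      ((ϖ * ratPlusSymbol f (((t * (u : ZMod (p ^ (n + cyclotomicExponent p)))).val : ℚ) /
        (p : ℚ) ^ (n + cyclotomicExponent p)) : ℚ) : ℚ_[p])) =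
      ((ϖ * teichOrbitSum f p (n + cyclotomicExponent p) (u : ZMod (p ^ (n + cyclotomicExponent p))) : ℚ) :
        ℚ_[p]) := by
    rw [teichOrbitSum_def, Finset.mul_sum, Rat.cast_sum]
  rw [hsum, Rat.cast_mul, norm_mul, hϖ1, one_mul]
  exact le_antisymm (norm_teichOrbitSum_le_one hint _ _) hu

end Coset

/-! ### §C THE REGISTERED STUB S3 -/

section Stub

/-- **stub S3 of the skeleton of record (finemu5 r2 ⊕ multteich5), PROVED — `stub_multMuAn_of_orbitUnit`.**  Mazur's
Manin-constant fact (displayed) → Wuthrich Cor. 18 (displayed; not used) → for `E = W/ℚ` with multiplicative reduction at `p ≥ 5` and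
`E[p]` irreducible: a Teichmüller orbit sum of level `n ≥ 1` over a unit with norm `≥ 1` for every newform (`MultTeichOrbitUnitAt W p`)
gives, for every newform `f`, period ratio `ϖ` and Mazur–Tate–Teitelbaum function `L` with the allowable root `a = ±1`, a coefficient
of `ϖ·L` of norm `1` (`MultMuAnAt W p`).  Proof in the module docstring; no analytic-rank hypothesis; `5 ≤ p` is used only as `p ≠ 2`.
[cite: MazurTateTeitelbaum1986Invent, §I.10 (10.1), §I.12–I.13] [cite: Mazur1978, Cor. 4.1] [cite: GreenbergVatsal2000, §3 Rem. 3.4] -/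
theorem stub_multMuAn_of_orbitUnit :
    ModularForms.mazur_not_dvd_maninConstant_of_odd →
    Wuthrich2014.corollary18_padicLFunction_mem_iwasawaAlgebra_multiplicative →
    ∀ (W : WeierstrassCurve ℚ) [W.IsElliptic] [W.IsGloballyMinimal] (p : ℕ) [Fact p.Prime],
      5 ≤ p → Mult W p → Irr W p → MultTeichOrbitUnitAt W p → MultMuAnAt W p := by
  intro hMz _h18 W _ _ p _ hp5 hmult hirr horb N _ f hf ϖ hϖ a L hsa hna hL
  have hp : p.Prime := Fact.out
  have hp2 : p ≠ 2 := by omega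
  have he : cyclotomicExponent p = 1 := if_neg hp2
  -- `‖ϖ‖_p = 1` (Mazur) and `‖[0]⁺_f‖_p ≤ 1` (irreducibility), hence the whole table is `p`-integral
  have hϖ1 : ‖((ϖ : ℚ) : ℚ_[p])‖ = 1 :=
    X11b.ClassClosure.norm_ratCast_periodRatio_eq_one_of_mazur W p hMz hp2 hmult hirr hf hϖ
  obtain ⟨n₀, hpn₀, h0Λ⟩ :=
    exists_intCast_mul_modularSymbol_zero_mem not_irreducible_of_frobeniusTrace_congr_holds hf hirr
  have h00 : ‖((ratPlusSymbol f 0 : ℚ) : ℚ_[p])‖ ≤ 1 :=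
    norm_ratPlusSymbol_le_one f hp2 hpn₀ h0Λ (by rw [Rat.den_zero]; exact Nat.coprime_one_left N)
  have hintZ : ∀ (m : ℕ) (b : ZMod (p ^ m)),
      ‖((ratPlusSymbol f ((b.val : ℚ) / (p : ℚ) ^ m) : ℚ) : ℚ_[p])‖ ≤ 1 := fun m b ↦
    (hf.norm_ratPlusSymbol_val_div_le_max_of_multiplicative hp2 hmult m b).trans (max_le le_rfl h00)
  have hintk : ∀ (k m : ℕ), ‖((ratPlusSymbol f ((k : ℚ) / (p : ℚ) ^ m) : ℚ) : ℚ_[p])‖ ≤ 1 := by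
    intro k m
    have h := ratPlusSymbol_intCast_div_pow (f := f) (p := p) m (k : ℤ)
    rw [Int.cast_natCast] at h
    rw [h]
    exact hintZ m _
  have hintϖ : ∀ (m : ℕ) (b : ZMod (p ^ m)),
      ‖((ϖ * ratPlusSymbol f ((b.val : ℚ) / (p : ℚ) ^ m) : ℚ) : ℚ_[p])‖ ≤ 1 := by
    intro m b
    rw [Rat.cast_mul, norm_mul, hϖ1, one_mul]
    exact hintZ m b
  -- the unit orbit sum, at a level of the form `n + e₀` (`e₀ = 1`, `n₁ ≥ 1`)
  obtain ⟨n₁, hn₁, u₁, hu₁⟩ := horb f hf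
  obtain ⟨n, rfl⟩ : ∃ n, n₁ = n + cyclotomicExponent p := ⟨n₁ - 1, by rw [he]; omega⟩
  obtain ⟨s₀, hunit⟩ := exists_norm_finsum_coset_eq_one_of_teichOrbitSum f hp2 ϖ hϖ1 hintk n u₁ hu₁
  -- the tree's coset-sum certificate for THE function of the reduction sign's kind
  by_cases hs : W.HasSplitMultiplicativeReductionAtPrime p
  · have ha : a = 1 := hsa hs
    subst ha
    obtain ⟨k, -, hk⟩ := X11a.MuCoset.exists_norm_coeff_eq_one_of_cosetSum_split W p hf hs ϖ hintϖ s₀ hunit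
      ((isMultPAdicLFunctionOf_one_iff L).mp hL)
    exact ⟨k, hk⟩
  · have ha : a = -1 := hna hs
    subst ha
    obtain ⟨k, -, hk⟩ := X11a.MuCoset.exists_norm_coeff_eq_one_of_cosetSum_nonsplit W p hf hmult hs ϖ hintϖ s₀
      hunit hL
    exact ⟨k, hk⟩

end Stub

/-! ### §D `p`-GENERIC FORM (odd `p`; the shape shared with line «multspan3» on U3, item 20613) -/

section Generic

/-- **Odd-`p` form of S3** (the signature of ideator bsd-idea-17's v4 stub `stub_multMuAn_of_orbitUnit`, SHARED VERBATIM by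
«multteich5» (U5) and «multspan3» (U3, `p = 3`)): Mazur's Manin-constant fact → Wuthrich Cor. 18 (not used) → for `E = W/ℚ` with
multiplicative reduction at an ODD prime `p` and `E[p]` irreducible, `MultTeichOrbitUnitAt W p → MultMuAnAt W p`.  Same proof as the
registered `5 ≤ p` form (which used `5 ≤ p` only as `p ≠ 2`). [cite: MazurTateTeitelbaum1986Invent, §I.10 (10.1), §I.12–I.13]
[cite: Mazur1978, Cor. 4.1] -/
theorem multMuAnAt_of_orbitUnitAt :
    ModularForms.mazur_not_dvd_maninConstant_of_odd →
    Wuthrich2014.corollary18_padicLFunction_mem_iwasawaAlgebra_multiplicative →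
    ∀ (W : WeierstrassCurve ℚ) [W.IsElliptic] [W.IsGloballyMinimal] (p : ℕ) [Fact p.Prime],
      p ≠ 2 → Mult W p → Irr W p → MultTeichOrbitUnitAt W p → MultMuAnAt W p := by
  intro hMz _h18 W _ _ p _ hp2 hmult hirr horb N _ f hf ϖ hϖ a L hsa hna hL
  have hp : p.Prime := Fact.out
  have he : cyclotomicExponent p = 1 := if_neg hp2
  have hϖ1 : ‖((ϖ : ℚ) : ℚ_[p])‖ = 1 :=
    X11b.ClassClosure.norm_ratCast_periodRatio_eq_one_of_mazur W p hMz hp2 hmult hirr hf hϖ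
  obtain ⟨n₀, hpn₀, h0Λ⟩ :=
    exists_intCast_mul_modularSymbol_zero_mem not_irreducible_of_frobeniusTrace_congr_holds hf hirr
  have h00 : ‖((ratPlusSymbol f 0 : ℚ) : ℚ_[p])‖ ≤ 1 :=
    norm_ratPlusSymbol_le_one f hp2 hpn₀ h0Λ (by rw [Rat.den_zero]; exact Nat.coprime_one_left N)
  have hintZ : ∀ (m : ℕ) (b : ZMod (p ^ m)),
      ‖((ratPlusSymbol f ((b.val : ℚ) / (p : ℚ) ^ m) : ℚ) : ℚ_[p])‖ ≤ 1 := fun m b ↦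
    (hf.norm_ratPlusSymbol_val_div_le_max_of_multiplicative hp2 hmult m b).trans (max_le le_rfl h00)
  have hintk : ∀ (k m : ℕ), ‖((ratPlusSymbol f ((k : ℚ) / (p : ℚ) ^ m) : ℚ) : ℚ_[p])‖ ≤ 1 := by
    intro k m
    have h := ratPlusSymbol_intCast_div_pow (f := f) (p := p) m (k : ℤ)
    rw [Int.cast_natCast] at h
    rw [h]
    exact hintZ m _
  have hintϖ : ∀ (m : ℕ) (b : ZMod (p ^ m)),
      ‖((ϖ * ratPlusSymbol f ((b.val : ℚ) / (p : ℚ) ^ m) : ℚ) : ℚ_[p])‖ ≤ 1 := by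
    intro m b
    rw [Rat.cast_mul, norm_mul, hϖ1, one_mul]
    exact hintZ m b
  obtain ⟨n₁, hn₁, u₁, hu₁⟩ := horb f hf
  obtain ⟨n, rfl⟩ : ∃ n, n₁ = n + cyclotomicExponent p := ⟨n₁ - 1, by rw [he]; omega⟩
  obtain ⟨s₀, hunit⟩ := exists_norm_finsum_coset_eq_one_of_teichOrbitSum f hp2 ϖ hϖ1 hintk n u₁ hu₁
  by_cases hs : W.HasSplitMultiplicativeReductionAtPrime p
  · have ha : a = 1 := hsa hs
    subst ha
    obtain ⟨k, -, hk⟩ := X11a.MuCoset.exists_norm_coeff_eq_one_of_cosetSum_split W p hf hs ϖ hintϖ s₀ hunit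
      ((isMultPAdicLFunctionOf_one_iff L).mp hL)
    exact ⟨k, hk⟩
  · have ha : a = -1 := hna hs
    subst ha
    obtain ⟨k, -, hk⟩ := X11a.MuCoset.exists_norm_coeff_eq_one_of_cosetSum_nonsplit W p hf hmult hs ϖ hintϖ s₀
      hunit hL
    exact ⟨k, hk⟩

end Generic

end Summit.BirchSwinnertonDyer.BirchSwinnertonDyer.Cruxes.UpperNonSurjFive.MultTeich

end
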